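import Literature.MathematicalPhysics.QuantumFieldTheory.BalabanImbrieJaffe1984to88.BIJ88W6PrimeVsupp
import Literature.MathematicalPhysics.QuantumFieldTheory.BalabanImbrieJaffe1984to88.BIJ88W6PrimeBound

/-!
# `BalabanImbrieJaffe1984to88.BIJ88W6PrimeVsuppBound` — T. Bałaban, J. Imbrie, A. Jaffe, *Effective action and cluster properties of the abelian
Higgs model*, Commun. Math. Phys. **114** (1988) 257–315 [BalabanImbrieJaffe1988], Sect. 5.14, p. 310 [PDF 54]: **THE BOUND ON `W₆^{(k)′}` AS
PRINTED** — *"We bound them using (5.14.4) and standard techniques … The result is |W₆^{(k)′}(X)| ≤ (e^β(L^kε/ε₀)^{1/4−α})^{n̄+1+β′|X|}.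
(We allow adjustments in β, α, β′, keeping them small.)"* — FOR THE PRINTED `W₆′` OF THE SIBLING `BIJ88W6PrimeVsupp` (`W6v`: fill-`X` pieces of the
display-3 series on p25's cluster-configuration gas, assignments supported in `X`, `t`-integral as in (5.14.2)), landing in r16's typed leaf
`BIJ88Sect5StatementsPart2.IneqW6'` with p25's adjusted constants (`BIJ88W6PrimeBound.ineqW6'_holds`: `ϑ = θ^{1−β′}`, `β″ = β′/(4(1−β′))`).

statement-level skeleton of published theorems with citation tags; proofs where landed; nothing here is a claim about the Yang–Mills mass gap

PDF held: `paper:balaban1988-cmp114-bij-abelian-higgs-effective-action` (journal page = PDF page + 256); p. 310 = PDF 54 read this generation.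

WHAT IS REPRODUCED (unit `lit-balaban-p36`, generation 13 of the Phase-2 proof seat p36, file 6 of the display-4 chain; SKELETON row
**C2.Claim@310** (member; owner r16, head p25's `BIJ88W6PrimeBound.ineqW6'_holds` for p25's schematic model `W6'`) of
`HOME/lit-balaban-r16/ROWS-C2-part2.md`; HOME `run/shared/lean/pub/lit-balaban/`).  Steps (a)–(f) of p25's `BIJ88W6PrimeBound` for `W6v`:
* §0 `TrawFill_eq_zero_of_not_subset` / `TsumFill_eq_zero_of_not_subset` / `W6v_eq_zero_of_not_subset` (no family of polymers of `W₀` fills an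
  `X ⊄ W₀`), `abs_remR_le_of_bound` (*"integrating over t as in (5.14.2)"*: `|remR f n̄| ≤ sup_{(0,1]}|f| / (n̄+1)!`, no integrability needed).
* §1 `card_filter_supp_le` (the assignments supported in `X` number `≤ (G|X|)^{|L|}`, `G` slots per cube — p25's step (e)).
* §2 `abs_integrand_le` ((5.14.4) ⟹ `|Σ_{γ: supp ⊆ X} T^{fill X}_{γ,t}| ≤ (G|X|)^{n̄+1}·(θ^{β′/2})^{|X|}(θ^{1−β′})^{n̄+1}(n̄+1)!·4e²θ^{β′/2}(D+1)|X|`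
  on `(0,1]`, by `BIJ88ConnectedGraphFillingVsupp.abs_TsumFill_vsupp_le_of_ineq5144`), **`abs_W6v_le`**.
* §3 **`abs_W6v_le_rpow`** (`|W₆′(X)| ≤ θ^{(1−β′)(n̄+1)+(β′/4)|X|}` after the absorption `K(n̄+2)! ≤ ((β′/4)log θ⁻¹)^{n̄+2}`,
  `K = 4e²θ^{β′/2}(D+1)(n̄+1)G^{n̄+1}`, p25's `mul_pow_mul_rpow_le_one`), **`ineqW6'_W6v`**: r16's typed leaf
  `IneqW6' (cubeSys I) (W6v …) (θ^{1−β′}) (β′/(4(1−β′))) n̄`.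
HYPOTHESES (all explicit): gen 5's regime (`adj` symmetric of degree `≤ D`, `0 < θ ≤ 1`, `0 ≤ β′ < 1`, `16(D+1)²θ^{β′/2}e² ≤ 1`), at most `G`
slots of `W₀` per cube, `|L| = n̄+1`, the absorption condition, and THE LEAF (5.14.4) for the located data of `W₀` at every `t ∈ (0,1]`
(`Ineq5144`, NOT proved here).  HONEST SCOPE: (a) constants are gen 5's KP-type ones, not optimized; (b) `W₆″` and the p. 311 combination are r16's
`BIJ88IneqW6FromLeaves`; (c) `(n̄+1)!` slip G-C2-p36-06 as in the head theorem.  0 `sorry`, 0 definitions, 0 `Prop` facts (D-0026); imports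
`BIJ88W6PrimeVsupp` (p36 g13) and `BIJ88W6PrimeBound` (p25); modifies nothing.  NOT summit progress; NOT continuum; NOT Clay.  Cell `lit-balaban`
Phase 2, seat p36 gen 13 (row owner r16, referee ref-5).
-/

noncomputable section

open Finset MeasureTheory
open Literature.MathematicalPhysics.QuantumFieldTheory.BalabanImbrieJaffe1984to88.BIJ88DirichletForms305 (interpForm)
open Literature.MathematicalPhysics.QuantumFieldTheory.BalabanImbrieJaffe1984to88.BIJ88PolymerRep5134 (corner)
open Literature.MathematicalPhysics.QuantumFieldTheory.BalabanImbrieJaffe1984to88.BIJ88PolymerRep5134Gauss (zG)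
open Literature.MathematicalPhysics.QuantumFieldTheory.BalabanImbrieJaffe1984to88.BIJ88Expansion5143 (g3 prime)
open Literature.MathematicalPhysics.QuantumFieldTheory.BalabanImbrieJaffe1984to88.BIJ88Expansion5143Gauss (fD)
open Literature.MathematicalPhysics.QuantumFieldTheory.BalabanImbrieJaffe1984to88.BIJ88Expansion5143Ordered (polysOf cvsupp locv wv cubesOf
  cubesOf_vsupp)
open Literature.MathematicalPhysics.QuantumFieldTheory.BalabanImbrieJaffe1984to88.BIJ88Expansion5143Obs (mem_polysOf)
open Literature.MathematicalPhysics.QuantumFieldTheory.BalabanImbrieJaffe1984to88.BIJ88ConnectedGraphResummation (OWP InQ Cov wprod)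
open Literature.MathematicalPhysics.QuantumFieldTheory.BalabanImbrieJaffe1984to88.BIJ88ConnectedGraphFilling (TrawFill TordFill TsumFill)
open Literature.MathematicalPhysics.QuantumFieldTheory.BalabanImbrieJaffe1984to88.BIJ88ConnectedGraphFillingVsupp (abs_TsumFill_vsupp_le_of_ineq5144)
open Literature.MathematicalPhysics.QuantumFieldTheory.BalabanImbrieJaffe1984to88.BIJ88SlotMomentsGauss308 (uD)
open Literature.MathematicalPhysics.QuantumFieldTheory.BalabanImbrieJaffe1984to88.BIJ88Sect5Statements (CutoffProfile)
open Literature.MathematicalPhysics.QuantumFieldTheory.BalabanImbrieJaffe1984to88.BIJ88Sect5StatementsPart2 (Ineq5144 IneqW6')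
open Literature.MathematicalPhysics.QuantumFieldTheory.BalabanImbrieJaffe1984to88.BIJ88Sect5StatementsPart4 (remR)
open Literature.MathematicalPhysics.QuantumFieldTheory.BalabanImbrieJaffe1984to88.BIJ88Ineq5113Covering (cubeSys cubeSys_card)
open Literature.MathematicalPhysics.QuantumFieldTheory.BalabanImbrieJaffe1984to88.BIJ88W6PrimeBound (mul_pow_mul_rpow_le_one)
open Literature.MathematicalPhysics.QuantumFieldTheory.BalabanImbrieJaffe1984to88.BIJ88Eq5145CornerModel (slotB slotY)
open Literature.MathematicalPhysics.QuantumFieldTheory.BalabanImbrieJaffe1984to88.BIJ88Eq5145CornerUrsell (cubeIn cubeIn_mem)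
open Literature.MathematicalPhysics.QuantumFieldTheory.BalabanImbrieJaffe1984to88.BIJ88W6PrimeVsupp (actIn W6v W6v_def)

namespace Literature.MathematicalPhysics.QuantumFieldTheory.BalabanImbrieJaffe1984to88.BIJ88W6PrimeVsuppBound

/-! ## §0 No family of polymers of `W₀` fills a set of cubes not inside `W₀` -/

section Generic

variable {V : Type*} {S : Type*} {κ : Type*} [DecidableEq V] [Fintype V] [DecidableEq S] [Fintype S] [DecidableEq κ]

/-- if every polymer of the family has its cubes in `W₀`, no family fills an `X ⊄ W₀`: the fill-`X` raw sum vanishes.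
[cite: BalabanImbrieJaffe1988, p.310 (Sect. 5.14)] -/
theorem TrawFill_eq_zero_of_not_subset {Q : Finset (Finset V)} {loc : S → V} {w : Finset S → Finset V → ℝ} {U : Finset V → Finset κ}
    {W₀ X : Finset κ} (hU : ∀ Z ∈ Q, U Z ⊆ W₀) (hX : ¬ X ⊆ W₀) (ι : Type*) [Fintype ι] [DecidableEq ι] (K : Finset S) :
    TrawFill Q loc w U X ι K = 0 := by
  unfold TrawFill
  refine sum_eq_zero fun Hs _ => sum_eq_zero fun Z _ => if_neg ?_
  rintro ⟨-, hQ, -, hfill⟩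
  exact hX (hfill ▸ Finset.biUnion_subset.2 fun i _ => hU _ (hQ i))

/-- … hence so does the fill-`X` truncated function. [cite: BalabanImbrieJaffe1988, p.310 (Sect. 5.14)] -/
theorem TsumFill_eq_zero_of_not_subset {Q : Finset (Finset V)} {loc : S → V} {w : Finset S → Finset V → ℝ} {U : Finset V → Finset κ}
    {W₀ X : Finset κ} (hU : ∀ Z ∈ Q, U Z ⊆ W₀) (hX : ¬ X ⊆ W₀) (K : Finset S) : TsumFill Q loc w U X K = 0 := by
  unfold TsumFill TordFill
  simp only [TrawFill_eq_zero_of_not_subset hU hX, zero_div, tsum_zero]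

/-- **`|remR f n̄| ≤ M/(n̄+1)!` when `|f| ≤ M` on `(0,1]`** (*"integrating over t as in (5.14.2)"*: the weight `(1−t)^{n̄}/(n̄+1)!` is at most
`1/(n̄+1)!` on `[0,1]`; no integrability needed). [cite: BalabanImbrieJaffe1988, (5.14.2) p.308] -/
theorem abs_remR_le_of_bound {f : ℝ → ℝ} {M : ℝ} (h : ∀ t ∈ Set.Ioc (0 : ℝ) 1, |f t| ≤ M) (nbar : ℕ) :
    |remR f nbar| ≤ M / ((nbar + 1).factorial : ℝ) := by
  unfold remR
  have key := intervalIntegral.norm_integral_le_of_norm_le_const (a := (0 : ℝ)) (b := 1) (C := M / ((nbar + 1).factorial : ℝ))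
    (f := fun t => -((1 - t) ^ nbar / ((nbar + 1).factorial : ℝ)) * f t) fun t ht => by
      rw [Set.uIoc_of_le zero_le_one] at ht
      have h1 : |(1 - t) ^ nbar / ((nbar + 1).factorial : ℝ)| ≤ 1 / ((nbar + 1).factorial : ℝ) := by
        rw [abs_div, abs_of_nonneg (pow_nonneg (by linarith [ht.2]) _), abs_of_pos (by positivity)]
        exact div_le_div_of_nonneg_right (pow_le_one₀ (by linarith [ht.2]) (by linarith [ht.1])) (by positivity)
      calc ‖-((1 - t) ^ nbar / ((nbar + 1).factorial : ℝ)) * f t‖ = |(1 - t) ^ nbar / ((nbar + 1).factorial : ℝ)| * |f t| := by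
            rw [Real.norm_eq_abs, abs_mul, abs_neg]
        _ ≤ 1 / ((nbar + 1).factorial : ℝ) * M := mul_le_mul h1 (h t ht) (abs_nonneg _) (by positivity)
        _ = M / ((nbar + 1).factorial : ℝ) := by ring
  simpa only [Real.norm_eq_abs, sub_zero, abs_one, mul_one] using key

end Generic

variable {α I : Type} [Fintype α] [DecidableEq α] [Fintype I] [DecidableEq I]
  (blk : α → I) (Δ : Matrix α α ℝ) (ℱ : α → ℝ)
variable (adj : I → I → Prop) [DecidableRel adj]
variable (χ : CutoffProfile) {ι υ : Type*} [DecidableEq ι] [DecidableEq υ]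
variable {p ek : ℝ} {B : Finset ι} {Φ : ι → (α → ℝ) → ℝ} {c : ι → ℝ} {Ys : Finset υ} {V : υ → (α → ℝ) → ℝ}
variable {cube : ↥B ⊕ ↥Ys → I} (Λ : Finset I)

/-- **`W₆′(X) = 0` UNLESS `X ⊆ W₀`** (the polymers of the `W₀`-gas have their cubes in `W₀`). [cite: BalabanImbrieJaffe1988, p.310 (Sect. 5.14)] -/
theorem W6v_eq_zero_of_not_subset {X W₀ : Finset I} (hX : ¬ X ⊆ W₀) (L : Type) [Fintype L] [DecidableEq L] (nbar : ℕ) :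
    W6v blk Δ ℱ adj χ p ek B Φ c Ys V cube Λ W₀ L nbar X = 0 := by
  have hU : ∀ Z ∈ (polysOf W₀).image (cvsupp adj W₀), cubesOf Z ⊆ W₀ := fun Z hZ => by
    obtain ⟨Y, hY, rfl⟩ := mem_image.1 hZ
    rw [cubesOf_vsupp]
    exact (mem_polysOf.1 hY).1
  rw [W6v_def]
  simp only [TsumFill_eq_zero_of_not_subset hU hX, sum_const_zero, remR, mul_zero, intervalIntegral.integral_zero]

/-! ## §1 The assignment count (p25's step (e)) -/

omit [Fintype α] [DecidableEq α] [Fintype I] [DecidableEq ι] [DecidableEq υ] in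
/-- the slots located in a region `X₀` at the cube `i` are among the (global) slots at the cube `i`: a per-cube bound on the χ-slots and
interaction terms of p. 308 bounds the located ones of every region. [cite: BalabanImbrieJaffe1988, (5.14.2) p.308] -/
theorem card_filter_cubeIn_le [Fintype ι] [Fintype υ] (X₀ : Finset I) (i : I) :
    (univ.filter fun τ : ↥(slotB B Ys cube X₀) ⊕ ↥(slotY B Ys cube X₀) => cubeIn cube X₀ τ = i).card ≤
      (univ.filter fun τ : ↥B ⊕ ↥Ys => cube τ = i).card := by
  refine Finset.card_le_card_of_injOn (Sum.map (fun b => b.1) (fun Y => Y.1)) (fun τ hτ => ?_) (fun τ₁ _ τ₂ _ h => ?_)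
  · simp only [mem_coe, mem_filter, mem_univ, true_and] at hτ ⊢
    rcases τ with b | Y
    · exact hτ
    · exact hτ
  · rcases τ₁ with b₁ | Y₁ <;> rcases τ₂ with b₂ | Y₂
    · simp only [Sum.map_inl, Sum.inl.injEq] at h
      rw [Subtype.ext h]
    · simp only [Sum.map_inl, Sum.map_inr, reduceCtorEq] at h
    · simp only [Sum.map_inl, Sum.map_inr, reduceCtorEq] at h
    · simp only [Sum.map_inr, Sum.inr.injEq] at h
      rw [Subtype.ext h]

omit [Fintype α] [DecidableEq α] [Fintype I] [DecidableEq ι] [DecidableEq υ] in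
/-- **the assignments of `|L|` labels to the slots of `W₀` with every cube in `X` number at most `(G|X|)^{|L|}`** when every cube carries at most
`G` slots (p. 310: the sum over `{γ_j}` with `suppt(d/dt)_{γ_j} ⊂ X`). [cite: BalabanImbrieJaffe1988, p.310 (Sect. 5.14)] -/
theorem card_filter_supp_le {W₀ : Finset I} {G : ℕ}
    (hG : ∀ i, (univ.filter fun τ : ↥(slotB B Ys cube W₀) ⊕ ↥(slotY B Ys cube W₀) => cubeIn cube W₀ τ = i).card ≤ G)
    (L : Type) [Fintype L] [DecidableEq L] (X : Finset I) :
    ((univ.filter fun γ : L → ↥(slotB B Ys cube W₀) ⊕ ↥(slotY B Ys cube W₀) => ∀ l, cubeIn cube W₀ (γ l) ∈ X).card : ℝ) ≤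
      ((G : ℝ) * X.card) ^ Fintype.card L := by
  have h1 : (univ.filter fun τ : ↥(slotB B Ys cube W₀) ⊕ ↥(slotY B Ys cube W₀) => cubeIn cube W₀ τ ∈ X).card ≤ G * X.card := by
    rw [card_eq_sum_card_fiberwise (f := cubeIn cube W₀) (t := X) (fun τ hτ => by exact (mem_filter.1 (mem_coe.1 hτ)).2)]
    calc ∑ q ∈ X, ((univ.filter fun τ : ↥(slotB B Ys cube W₀) ⊕ ↥(slotY B Ys cube W₀) => cubeIn cube W₀ τ ∈ X).filter
          fun τ => cubeIn cube W₀ τ = q).card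
        ≤ ∑ q ∈ X, (univ.filter fun τ : ↥(slotB B Ys cube W₀) ⊕ ↥(slotY B Ys cube W₀) => cubeIn cube W₀ τ = q).card :=
          sum_le_sum fun q _ => card_le_card fun τ hτ => by
            simp only [mem_filter, mem_univ, true_and] at hτ ⊢
            exact hτ.2
      _ ≤ ∑ _q ∈ X, G := sum_le_sum fun q _ => hG q
      _ = G * X.card := by rw [sum_const, smul_eq_mul, mul_comm]
  have heq : (univ.filter fun γ : L → ↥(slotB B Ys cube W₀) ⊕ ↥(slotY B Ys cube W₀) => ∀ l, cubeIn cube W₀ (γ l) ∈ X) =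
      Fintype.piFinset fun _ : L => univ.filter fun τ : ↥(slotB B Ys cube W₀) ⊕ ↥(slotY B Ys cube W₀) => cubeIn cube W₀ τ ∈ X := by
    ext γ
    simp only [mem_filter, mem_univ, true_and, Fintype.mem_piFinset]
  rw [heq, Fintype.card_piFinset, prod_const, card_univ, Nat.cast_pow]
  exact pow_le_pow_left₀ (Nat.cast_nonneg _) (by exact_mod_cast h1) _

/-! ## §2 The integrand bound and `|W₆′(X)|`, modulo (5.14.4) -/

/-- **(5.14.4) ⟹ THE INTEGRAND OF `W₆′(X)` IS BOUNDED ON `(0,1]`**: for `X ⊆ W₀` and the leaf for the located data of `W₀` at `t`,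
`|Σ_{γ : supp ⊆ X} T^{fill X}_{γ,t}(L)| ≤ (G|X|)^{|L|}·(θ^{β′/2})^{|X|}·((θ^{1−β′})^{|L|}·|L|!·4e²θ^{β′/2}(D+1)·|X|)`
(`BIJ88ConnectedGraphFillingVsupp.abs_TsumFill_vsupp_le_of_ineq5144` per assignment + `card_filter_supp_le`).
[cite: BalabanImbrieJaffe1988, p.310 (Sect. 5.14); (5.14.4) p.309] -/
theorem abs_integrand_le {nbr : I → Finset I} {D : ℕ} {θ β' : ℝ} (hR : ∀ x y, adj x y → adj y x) (hD : ∀ x, (nbr x).card ≤ D)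
    (hnbr : ∀ x y, adj x y → y ∈ nbr x) (hθ0 : 0 < θ) (hθ1 : θ ≤ 1) (hβ : 0 ≤ β') (hsmall : 16 * ((D : ℝ) + 1) ^ 2 * (θ ^ (β' / 2) * Real.exp 2) ≤ 1)
    {X W₀ : Finset I} (hXW : X ⊆ W₀) {G : ℕ}
    (hG : ∀ i, (univ.filter fun τ : ↥(slotB B Ys cube W₀) ⊕ ↥(slotY B Ys cube W₀) => cubeIn cube W₀ τ = i).card ≤ G)
    (L : Type) [Fintype L] [DecidableEq L] [Nonempty L] {t : ℝ}
    (h5144 : ∀ γ : L → ↥(slotB B Ys cube W₀) ⊕ ↥(slotY B Ys cube W₀), Ineq5144 (cubeSys I) (Finset L)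
      (actIn blk Δ ℱ adj χ p ek B Φ c Ys V cube Λ W₀ t γ) Finset.card (fun H (X'' : Finset I) => (X'' \ H.image (cubeIn cube W₀ ∘ γ)).card) θ β') :
    |∑ γ ∈ univ.filter (fun γ : L → ↥(slotB B Ys cube W₀) ⊕ ↥(slotY B Ys cube W₀) => ∀ l, cubeIn cube W₀ (γ l) ∈ X),
        TsumFill ((polysOf W₀).image (cvsupp adj W₀)) (locv (cubeIn cube W₀ ∘ γ)) (wv (actIn blk Δ ℱ adj χ p ek B Φ c Ys V cube Λ W₀ t γ))
          cubesOf X univ| ≤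
      ((G : ℝ) * X.card) ^ Fintype.card L * ((θ ^ (β' / 2)) ^ X.card * ((θ ^ (1 - β')) ^ Fintype.card L * (Fintype.card L).factorial *
        (2 * (2 * Real.exp 2 * θ ^ (β' / 2) * ((D : ℝ) + 1)) * X.card))) := by
  have hB : 0 ≤ (θ ^ (β' / 2)) ^ X.card * ((θ ^ (1 - β')) ^ Fintype.card L * (Fintype.card L).factorial *
      (2 * (2 * Real.exp 2 * θ ^ (β' / 2) * ((D : ℝ) + 1)) * X.card)) := by positivity
  refine (abs_sum_le_sum_abs _ _).trans (((sum_le_sum fun γ _ =>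
    abs_TsumFill_vsupp_le_of_ineq5144 hR hD hnbr hθ0 hθ1 hβ hsmall (h5144 γ) hXW univ_nonempty)).trans ?_)
  rw [sum_const, nsmul_eq_mul, card_univ]
  exact mul_le_mul_of_nonneg_right (card_filter_supp_le hG L X) hB

/-- **`|W₆^{(k)′}(X)|`, QUANTITATIVE FORM, MODULO (5.14.4)** (p25's steps (a)–(f) for the printed `W₆′`): for `X ⊆ W₀`, `|L| = n̄+1`, at most `G`
slots of `W₀` per cube, gen 5's regime and the leaf for the located data of `W₀` at every `t ∈ (0,1]`,
`|W₆′(X)| ≤ 4e²θ^{β′/2}(D+1)(n̄+1)·G^{n̄+1}|X|^{n̄+2}·(θ^{1−β′})^{n̄+1}(θ^{β′/2})^{|X|}` (`abs_integrand_le` on `(0,1]`, `abs_remR_le_of_bound`,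
`(n̄+1)·(n̄+1)!/(n̄+1)! = n̄+1`). [cite: BalabanImbrieJaffe1988, p.310 (Sect. 5.14); (5.14.2) p.308; (5.14.4) p.309] -/
theorem abs_W6v_le {nbr : I → Finset I} {D : ℕ} {θ β' : ℝ} (hR : ∀ x y, adj x y → adj y x) (hD : ∀ x, (nbr x).card ≤ D)
    (hnbr : ∀ x y, adj x y → y ∈ nbr x) (hθ0 : 0 < θ) (hθ1 : θ ≤ 1) (hβ : 0 ≤ β') (hsmall : 16 * ((D : ℝ) + 1) ^ 2 * (θ ^ (β' / 2) * Real.exp 2) ≤ 1)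
    {X W₀ : Finset I} (hXW : X ⊆ W₀) {G : ℕ}
    (hG : ∀ i, (univ.filter fun τ : ↥(slotB B Ys cube W₀) ⊕ ↥(slotY B Ys cube W₀) => cubeIn cube W₀ τ = i).card ≤ G)
    (L : Type) [Fintype L] [DecidableEq L] {nbar : ℕ} (hL : Fintype.card L = nbar + 1)
    (h5144 : ∀ t ∈ Set.Ioc (0 : ℝ) 1, ∀ γ : L → ↥(slotB B Ys cube W₀) ⊕ ↥(slotY B Ys cube W₀), Ineq5144 (cubeSys I) (Finset L)
      (actIn blk Δ ℱ adj χ p ek B Φ c Ys V cube Λ W₀ t γ) Finset.card (fun H (X'' : Finset I) => (X'' \ H.image (cubeIn cube W₀ ∘ γ)).card) θ β') :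
    |W6v blk Δ ℱ adj χ p ek B Φ c Ys V cube Λ W₀ L nbar X| ≤
      4 * Real.exp 2 * θ ^ (β' / 2) * ((D : ℝ) + 1) * (nbar + 1 : ℝ) * (G : ℝ) ^ (nbar + 1) * (X.card : ℝ) ^ (nbar + 2) *
        ((θ ^ (1 - β')) ^ (nbar + 1) * (θ ^ (β' / 2)) ^ X.card) := by
  haveI : Nonempty L := Fintype.card_pos_iff.1 (by omega)
  have hI := fun t (ht : t ∈ Set.Ioc (0 : ℝ) 1) =>
    abs_integrand_le blk Δ ℱ adj χ Λ hR hD hnbr hθ0 hθ1 hβ hsmall hXW hG L (h5144 t ht)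
  rw [hL] at hI
  have hrem := abs_remR_le_of_bound hI nbar
  have hfac : ((nbar + 1).factorial : ℝ) ≠ 0 := by positivity
  rw [W6v_def, abs_mul, abs_of_nonneg (by positivity : (0 : ℝ) ≤ nbar + 1)]
  refine (mul_le_mul_of_nonneg_left hrem (by positivity)).trans (le_of_eq ?_)
  field_simp
  ring

/-! ## §3 The printed shape and r16's typed leaf `IneqW6'` -/

/-- **`|W₆^{(k)′}(X)| ≤ θ^{(1−β′)(n̄+1) + (β′/4)|X|}` — THE PRINTED SHAPE, MODULO (5.14.4)** (p. 310 *"The result is |W₆^{(k)′}(X)| ≤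
(e^β(L^kε/ε₀)^{1/4−α})^{n̄+1+β′|X|}. (We allow adjustments in β, α, β′, keeping them small.)"*): `abs_W6v_le` for `X ⊆ W₀`
(`W6v_eq_zero_of_not_subset` otherwise) and the absorption `K|X|^{n̄+2}θ^{(β′/4)|X|} ≤ 1` under `K(n̄+2)! ≤ ((β′/4) log θ⁻¹)^{n̄+2}`,
`K = 4e²θ^{β′/2}(D+1)(n̄+1)G^{n̄+1}` (p25's `BIJ88W6PrimeBound.mul_pow_mul_rpow_le_one`). [cite: BalabanImbrieJaffe1988, p.310 (Sect. 5.14); (5.14.4) p.309] -/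
theorem abs_W6v_le_rpow {nbr : I → Finset I} {D : ℕ} {θ β' : ℝ} (hR : ∀ x y, adj x y → adj y x) (hD : ∀ x, (nbr x).card ≤ D)
    (hnbr : ∀ x y, adj x y → y ∈ nbr x) (hθ0 : 0 < θ) (hθ1 : θ ≤ 1) (hβ : 0 ≤ β') (hsmall : 16 * ((D : ℝ) + 1) ^ 2 * (θ ^ (β' / 2) * Real.exp 2) ≤ 1)
    (W₀ : Finset I) {G : ℕ} (hG : ∀ i, (univ.filter fun τ : ↥(slotB B Ys cube W₀) ⊕ ↥(slotY B Ys cube W₀) => cubeIn cube W₀ τ = i).card ≤ G)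
    (L : Type) [Fintype L] [DecidableEq L] {nbar : ℕ} (hL : Fintype.card L = nbar + 1)
    (habs : 4 * Real.exp 2 * θ ^ (β' / 2) * ((D : ℝ) + 1) * (nbar + 1 : ℝ) * (G : ℝ) ^ (nbar + 1) * (nbar + 2).factorial ≤
      (β' / 4 * Real.log θ⁻¹) ^ (nbar + 2))
    (h5144 : ∀ t ∈ Set.Ioc (0 : ℝ) 1, ∀ γ : L → ↥(slotB B Ys cube W₀) ⊕ ↥(slotY B Ys cube W₀), Ineq5144 (cubeSys I) (Finset L)
      (actIn blk Δ ℱ adj χ p ek B Φ c Ys V cube Λ W₀ t γ) Finset.card (fun H (X'' : Finset I) => (X'' \ H.image (cubeIn cube W₀ ∘ γ)).card) θ β')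
    (X : Finset I) :
    |W6v blk Δ ℱ adj χ p ek B Φ c Ys V cube Λ W₀ L nbar X| ≤ θ ^ ((1 - β') * (nbar + 1) + β' / 4 * X.card) := by
  by_cases hXW : X ⊆ W₀
  swap
  · rw [W6v_eq_zero_of_not_subset blk Δ ℱ adj χ Λ hXW L nbar, abs_zero]
    exact Real.rpow_nonneg hθ0.le _
  have h := abs_W6v_le blk Δ ℱ adj χ Λ hR hD hnbr hθ0 hθ1 hβ hsmall hXW hG L hL h5144
  set K : ℝ := 4 * Real.exp 2 * θ ^ (β' / 2) * ((D : ℝ) + 1) * (nbar + 1 : ℝ) * (G : ℝ) ^ (nbar + 1) with hK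
  have hK0 : 0 ≤ K := by positivity
  have habs' : K * (nbar + 2).factorial ≤ (β' / 4 * Real.log θ⁻¹) ^ (nbar + 2) := by rw [hK]; exact habs
  have hab := mul_pow_mul_rpow_le_one hθ0 hθ1 hK0 (by positivity : (0 : ℝ) ≤ β' / 4) (Nat.cast_nonneg X.card) (m := nbar + 2) habs'
  have hpow1 : (θ ^ (1 - β')) ^ (nbar + 1) = θ ^ ((1 - β') * (nbar + 1)) := by
    rw [← Real.rpow_natCast, ← Real.rpow_mul hθ0.le]; norm_cast
  have hpow2 : (θ ^ (β' / 2)) ^ X.card = θ ^ (β' / 4 * (X.card : ℝ)) * θ ^ (β' / 4 * (X.card : ℝ)) := by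
    rw [← Real.rpow_natCast, ← Real.rpow_mul hθ0.le, ← Real.rpow_add hθ0]; congr 1; ring
  have hgoal : θ ^ ((1 - β') * (nbar + 1) + β' / 4 * X.card) = θ ^ ((1 - β') * (nbar + 1)) * θ ^ (β' / 4 * (X.card : ℝ)) :=
    Real.rpow_add hθ0 _ _
  have hpos : 0 ≤ θ ^ ((1 - β') * (nbar + 1)) * θ ^ (β' / 4 * (X.card : ℝ)) := mul_nonneg (Real.rpow_nonneg hθ0.le _) (Real.rpow_nonneg hθ0.le _)
  calc |W6v blk Δ ℱ adj χ p ek B Φ c Ys V cube Λ W₀ L nbar X|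
      ≤ K * (X.card : ℝ) ^ (nbar + 2) * ((θ ^ (1 - β')) ^ (nbar + 1) * (θ ^ (β' / 2)) ^ X.card) := by rw [hK]; exact h
    _ = (θ ^ ((1 - β') * (nbar + 1)) * θ ^ (β' / 4 * (X.card : ℝ))) * (K * (X.card : ℝ) ^ (nbar + 2) * θ ^ (β' / 4 * (X.card : ℝ))) := by
        rw [hpow1, hpow2]; ring
    _ ≤ (θ ^ ((1 - β') * (nbar + 1)) * θ ^ (β' / 4 * (X.card : ℝ))) * 1 := mul_le_mul_of_nonneg_left hab hpos
    _ = θ ^ ((1 - β') * (nbar + 1) + β' / 4 * X.card) := by rw [mul_one, hgoal]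

/-- **r16's TYPED LEAF `IneqW6'` FOR THE PRINTED `W₆′` OF THE BOOKKEEPING OF RECORD, MODULO (5.14.4)** (row C2.Claim@310, p. 310): under the
hypotheses of `abs_W6v_le_rpow` and `β′ < 1`, `IneqW6' (cubeSys I) (W6v … W₀ L n̄) (θ^{1−β′}) (β′/(4(1−β′))) n̄` — verbatim the printed
`|W₆^{(k)′}(X)| ≤ ϑ^{n̄+1+β″|X|}` with p25's adjusted vertex factor `ϑ = θ^{1−β′}` and `β″ = β′/(4(1−β′))` (*"We allow adjustments in β, α,
β′"*), now for the `W₆′` whose region sum IS the `ℛ_k` of the (5.14.5) head theorem (`BIJ88W6PrimeVsupp.display4`); feeds r16's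
`BIJ88IneqW6FromLeaves.ineqW6_of_leaves` as its `hW6p`. [cite: BalabanImbrieJaffe1988, p.310 (Sect. 5.14); (5.14.4) p.309] -/
theorem ineqW6'_W6v {nbr : I → Finset I} {D : ℕ} {θ β' : ℝ} (hR : ∀ x y, adj x y → adj y x) (hD : ∀ x, (nbr x).card ≤ D)
    (hnbr : ∀ x y, adj x y → y ∈ nbr x) (hθ0 : 0 < θ) (hθ1 : θ ≤ 1) (hβ : 0 ≤ β') (hβ1 : β' < 1)
    (hsmall : 16 * ((D : ℝ) + 1) ^ 2 * (θ ^ (β' / 2) * Real.exp 2) ≤ 1)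
    (W₀ : Finset I) {G : ℕ} (hG : ∀ i, (univ.filter fun τ : ↥(slotB B Ys cube W₀) ⊕ ↥(slotY B Ys cube W₀) => cubeIn cube W₀ τ = i).card ≤ G)
    (L : Type) [Fintype L] [DecidableEq L] {nbar : ℕ} (hL : Fintype.card L = nbar + 1)
    (habs : 4 * Real.exp 2 * θ ^ (β' / 2) * ((D : ℝ) + 1) * (nbar + 1 : ℝ) * (G : ℝ) ^ (nbar + 1) * (nbar + 2).factorial ≤
      (β' / 4 * Real.log θ⁻¹) ^ (nbar + 2))
    (h5144 : ∀ t ∈ Set.Ioc (0 : ℝ) 1, ∀ γ : L → ↥(slotB B Ys cube W₀) ⊕ ↥(slotY B Ys cube W₀), Ineq5144 (cubeSys I) (Finset L)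
      (actIn blk Δ ℱ adj χ p ek B Φ c Ys V cube Λ W₀ t γ) Finset.card (fun H (X'' : Finset I) => (X'' \ H.image (cubeIn cube W₀ ∘ γ)).card) θ β') :
    IneqW6' (cubeSys I) (W6v blk Δ ℱ adj χ p ek B Φ c Ys V cube Λ W₀ L nbar) (θ ^ (1 - β')) (β' / (4 * (1 - β'))) nbar := by
  intro X
  have h := abs_W6v_le_rpow blk Δ ℱ adj χ Λ hR hD hnbr hθ0 hθ1 hβ hsmall W₀ hG L hL habs h5144 X
  have hb : (1 : ℝ) - β' ≠ 0 := by linarith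
  have hexp : (θ ^ (1 - β')) ^ ((nbar : ℝ) + 1 + β' / (4 * (1 - β')) * ((cubeSys I).card X : ℝ)) =
      θ ^ ((1 - β') * (nbar + 1) + β' / 4 * X.card) := by
    rw [← Real.rpow_mul hθ0.le, cubeSys_card]
    congr 1
    field_simp
  rw [hexp]
  exact h

end Literature.MathematicalPhysics.QuantumFieldTheory.BalabanImbrieJaffe1984to88.BIJ88W6PrimeVsuppBound

end
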